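import Literature.Probability.LatticeModels.IsingRegionExtension
import Literature.Probability.LatticeModels.IsingBoundaryMonotonicity
import Literature.Probability.LatticeModels.RandomClusterMultiCrossing
import HarnessLib

/-!
# Many separated `+` crossing clusters cost a geometric factor: successive conditioning for the Ising model

Topic `Literature/Probability/LatticeModels` (trunk `StatMech`, family `crit-ising`). This file is the
spin-Ising counterpart of `RandomClusterMultiCrossing.lean` (the "successive conditionings" of
Duminil-Copin–Smirnov, Clay Math. Proc. 15 (2012), proof of Thm. 6.1, eq. (6.1)), in the form used
for the a-priori (Aizenman–Burchard) estimate of the LEFTMOST spin-Ising Dobrushin interface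
(Chelkak–Duminil-Copin–Hongler–Kemppainen–Smirnov, C. R. Math. 352 (2014), §2, Rem. 4;
Kemppainen–Smirnov, Ann. Probab. 45 (2017), Rem. 2.10: "under positive associativity … the
sufficient condition … is a uniform upper bound for the probability of the crossing event of an
annular sector with alternating boundary conditions"). No planar topology and no BK inequality are
used; only the Markov property and the FKG inequality of the finite-volume Ising measures
`μ^ξ_{U;β,0} = isingMeasure G U β 0 (.fixed ξ)`.

**Setting.** Fix a region `U₀ ⊆ V` (think: the free sites of a band of lattice levels), rims `In`,
`Out`, and an *insulating set* `T₀ ⊆ V`. For `U ⊆ U₀` and a configuration `σ`, a *local `+` path* is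
a path of `G` all of whose vertices lie in `U` and carry spin `+1` (`plusGraph G U σ`);
`plusCrossing` is the event that some `+` vertex of `In ∩ U` is locally joined to `Out`, and
`plusArms j` that there are `j` such vertices pairwise NOT locally joined — `j` distinct local `+`
clusters of `U` crossing from `In` to `Out`. `PlusInsulated G T₀ U ξ` says that every vertex of `T₀`
outside `U` but adjacent to `U` carries the boundary spin `ξ = −1` (the explored frontier is `−`).

**Theorem** (`isingMeasure_real_plusArms_le_pow_mul`, `β ≥ 0`). If for every `U ⊆ U₀` and every
insulated `ξ` one crossing costs `θ`, `μ^ξ_U(plusCrossing U) ≤ θ`, then for all such `(U, ξ)`, all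
`j` and all decreasing measurable `F`, `μ^ξ_U(plusArms U j ∩ F) ≤ θ^j μ^ξ_U(F)`.

**Proof** (induction on `j`, as in the FK file; the planar "left-most crossing" is replaced by the
least crossing vertex `a` in a fixed linear order). Given `j + 1` separated crossing clusters, let
`K` be the local `+` cluster of `a` and `∂K` its frontier in `U` (the vertices of `U ∖ K` adjacent
to `K`; they are `−`). The fibre `{cluster = K₀}` is contained in the cylinder
`{σ = + on K₀, − on ∂K₀}`; by the Markov property (`isingMeasure_fixed_real_inter_spinCyl`) the
measure of an event cut by this cylinder is `μ(cylinder) · μ^{ξ'}_{U'}(event)` with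
`U' = U ∖ (K₀ ∪ ∂K₀)` and `ξ'` the boundary condition updated by the revealed spins — which is again
insulated, the new frontier being `−`. On the fibre the remaining `j` clusters are separated
crossing clusters of `U'` and "no vertex of `In` below `a` crosses in `U'`" is a decreasing event,
so the induction hypothesis applies fibrewise; re-summing the fibres (they partition the crossing
event) and the FKG inequality for the increasing `plusCrossing` against the decreasing `F`
(`isingMeasure_real_inter_le_mul_of_isLowerSet_of_isUpperSet`) give the last factor `θ`.

**Corollaries.** `isingMeasure_real_plusArmsAvoiding_le_pow` — arms avoiding the local clusters of
an exceptional seed set `Z ⊆ U₀` (for interfaces in a Dobrushin domain: the free sites next to the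
`+` arc), explored first; `isingMeasure_real_plusArmsAvoiding_inter_le` — the same against any event
determined off `U₀` under a measure of a larger volume (the input of the product over scales).
Everything is proved; the only definitions are the events and the two bookkeeping predicates.

## References

* H. Duminil-Copin, S. Smirnov, *Conformal invariance of lattice models*, Clay Math. Proc. 15
  (2012), §6.1, proof of Thm. 6.1, eq. (6.1). [DuminilCopinSmirnov2012Clay]
* A. Kemppainen, S. Smirnov, *Random curves, scaling limits and Loewner evolutions*, Ann. Probab.
  45 (2017) 698–779, Rem. 2.10 and §4 (arXiv:1212.6215). [KemppainenSmirnov2017]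
* D. Chelkak, H. Duminil-Copin, C. Hongler, A. Kemppainen, S. Smirnov, C. R. Math. Acad. Sci.
  Paris 352 (2014) 157–161, §2 Rem. 4. [CDHKSCRAS2014]
* S. Friedli, Y. Velenik, *Statistical Mechanics of Lattice Systems* (2017), Lemma 6.7 (consistency),
  Thm. 3.50 (FKG). [FriedliVelenik2017]
-/

noncomputable section

namespace Literature.Probability.LatticeModels

open MeasureTheory Finset SimpleGraph

/-! ### Events determined by finitely many spins; cylinders; the Markov property on a sub-cylinder -/

section Cylinder

variable {V : Type*}

/-- **An event determined by the spins of a finite set is measurable** (it is a finite union of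
cylinders). [folklore] -/
theorem measurableSet_of_determined (S : Finset V) {A : Set (SpinConfig V)}
    (hA : ∀ σ₁ σ₂ : SpinConfig V, (∀ x ∈ S, σ₁ x = σ₂ x) → (σ₁ ∈ A ↔ σ₂ ∈ A)) :
    MeasurableSet A := by
  classical
  set ext : (S → ℤˣ) → SpinConfig V := fun τ v ↦ if h : v ∈ S then τ ⟨v, h⟩ else 1 with hext
  have hAeq : A = ⋃ τ ∈ (Finset.univ.filter fun τ : S → ℤˣ ↦ ext τ ∈ A),
      {σ : SpinConfig V | ∀ x : S, σ x = τ x} := by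
    ext σ
    simp only [Set.mem_iUnion, Finset.mem_filter, Finset.mem_univ, true_and, Set.mem_setOf_eq,
      exists_prop]
    constructor
    · intro hσ
      refine ⟨fun x ↦ σ x, (hA σ _ fun x hx ↦ ?_).1 hσ, fun x ↦ rfl⟩
      simp [hext, hx]
    · rintro ⟨τ, hτ, hστ⟩
      refine (hA _ σ fun x hx ↦ ?_).1 hτ
      simp [hext, hx, hστ ⟨x, hx⟩]
  rw [hAeq]
  refine MeasurableSet.biUnion (Finset.countable_toSet _) fun τ _ ↦ ?_
  have : {σ : SpinConfig V | ∀ x : S, σ x = τ x} = ⋂ x : S, (fun σ : SpinConfig V ↦ σ x) ⁻¹' {τ x} := by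
    ext σ; simp
  rw [this]
  exact MeasurableSet.iInter fun x ↦ measurable_pi_apply (x : V) (measurableSet_singleton _)

/-- The **cylinder** of the finite set `S` at the pattern `π`: the configurations equal to `π` on
`S`. (Friedli–Velenik 2017, §6.2, cylinder events.) [cite: FriedliVelenik2017, §6.2] -/
def spinCyl (S : Finset V) (π : SpinConfig V) : Set (SpinConfig V) := {σ | ∀ v ∈ S, σ v = π v}

/-- Membership in a cylinder. [folklore] -/
theorem mem_spinCyl {S : Finset V} {π σ : SpinConfig V} : σ ∈ spinCyl S π ↔ ∀ v ∈ S, σ v = π v := Iff.rfl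

/-- Cylinders are measurable. [folklore] -/
theorem measurableSet_spinCyl (S : Finset V) (π : SpinConfig V) : MeasurableSet (spinCyl S π) :=
  measurableSet_of_determined S fun σ₁ σ₂ h ↦ by
    simp only [mem_spinCyl]
    exact forall₂_congr fun v hv ↦ by rw [h v hv]

variable [DecidableEq V]

/-- The boundary condition `ξ` **overridden by the pattern `π` on `S`** (the boundary condition of
the unexplored region after the spins of `S` have been revealed). [folklore] -/
def overrideOn (S : Finset V) (π ξ : SpinConfig V) : SpinConfig V := fun v ↦ if v ∈ S then π v else ξ v

/-- `overrideOn` on `S`. [folklore] -/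
theorem overrideOn_of_mem {S : Finset V} (π ξ : SpinConfig V) {v : V} (hv : v ∈ S) :
    overrideOn S π ξ v = π v := by simp [overrideOn, hv]

/-- `overrideOn` off `S`. [folklore] -/
theorem overrideOn_of_notMem {S : Finset V} (π ξ : SpinConfig V) {v : V} (hv : v ∉ S) :
    overrideOn S π ξ v = ξ v := by simp [overrideOn, hv]

variable (G : SimpleGraph V) [G.LocallyFinite] [Countable V]

/-- **The Markov property of the finite-volume Ising measure on a sub-cylinder** (Friedli–Velenik
2017, Lemma 6.7 / Exercise 6.13: conditionally on the spins of `S ⊆ U`, the law in `U ∖ S` is the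
finite-volume measure with the revealed spins as boundary condition): for a pattern `π` on `S` and a
measurable event `A` (meaningful for `S ⊆ U`; true in general),
`μ^ξ_U(A ∩ {σ = π on S}) = μ^ξ_U({σ = π on S}) · μ^{ξ[π on S]}_{U ∖ S}(A)`.
[cite: FriedliVelenik2017, Lemma 6.7] -/
theorem isingMeasure_fixed_inter_spinCyl (U S : Finset V) (β h : ℝ) (ξ π : SpinConfig V)
    {A : Set (SpinConfig V)} (hA : MeasurableSet A) :
    isingMeasure G U β h (.fixed ξ) (A ∩ spinCyl S π) =
      isingMeasure G U β h (.fixed ξ) (spinCyl S π) *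
        isingMeasure G (U \ S) β h (.fixed (overrideOn S π ξ)) A := by
  have hCyl := measurableSet_spinCyl S π
  have hdet : ∀ σ₁ σ₂ : SpinConfig V, (∀ x ∉ U \ S, σ₁ x = σ₂ x) → (σ₁ ∈ spinCyl S π ↔ σ₂ ∈ spinCyl S π) := by
    intro σ₁ σ₂ h12
    simp only [mem_spinCyl]
    refine forall₂_congr fun v hv ↦ ?_
    rw [h12 v (fun h' ↦ (Finset.mem_sdiff.1 h').2 hv)]
  rw [← lintegral_isingMeasure_fixed_consistent G (Finset.sdiff_subset : U \ S ⊆ U) β h ξ (hA.inter hCyl)]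
  simp_rw [isingMeasure_fixed_inter_of_determined_off G (U \ S) β h _ hA hCyl hdet]
  set c := isingMeasure G (U \ S) β h (.fixed (overrideOn S π ξ)) A with hc
  have hae := ae_eqOn_compl_isingMeasure_fixed G U β h ξ
  calc ∫⁻ σ, (spinCyl S π).indicator (fun _ ↦ isingMeasure G (U \ S) β h (.fixed σ) A) σ
        ∂isingMeasure G U β h (.fixed ξ)
      = ∫⁻ σ, (spinCyl S π).indicator (fun _ ↦ c) σ ∂isingMeasure G U β h (.fixed ξ) := by
        refine lintegral_congr_ae (hae.mono fun σ hσ ↦ ?_)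
        show (spinCyl S π).indicator _ σ = (spinCyl S π).indicator _ σ
        by_cases hmem : σ ∈ spinCyl S π
        · rw [Set.indicator_of_mem hmem, Set.indicator_of_mem hmem, hc]
          refine isingMeasure_fixed_congr_of_eqOn_compl G (U \ S) β h (fun x hx ↦ ?_) hA
          by_cases hxS : x ∈ S
          · rw [overrideOn_of_mem _ _ hxS, hmem x hxS]
          · have hxU : x ∉ U := fun hxU ↦ hx (Finset.mem_sdiff.2 ⟨hxU, hxS⟩)
            rw [overrideOn_of_notMem _ _ hxS, hσ x hxU]
        · rw [Set.indicator_of_notMem hmem, Set.indicator_of_notMem hmem]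
    _ = c * isingMeasure G U β h (.fixed ξ) (spinCyl S π) := lintegral_indicator_const hCyl c
    _ = _ := mul_comm _ _

/-- Real-valued form of `isingMeasure_fixed_inter_spinCyl`. [cite: FriedliVelenik2017, Lemma 6.7] -/
theorem isingMeasure_fixed_real_inter_spinCyl (U S : Finset V) (β h : ℝ) (ξ π : SpinConfig V)
    {A : Set (SpinConfig V)} (hA : MeasurableSet A) :
    (isingMeasure G U β h (.fixed ξ)).real (A ∩ spinCyl S π) =
      (isingMeasure G U β h (.fixed ξ)).real (spinCyl S π) *
        (isingMeasure G (U \ S) β h (.fixed (overrideOn S π ξ))).real A := by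
  simp only [Measure.real, isingMeasure_fixed_inter_spinCyl G U S β h ξ π hA, ENNReal.toReal_mul]

/-- **One step of successive conditioning, the bound being required only on the support**
(variant of `isingMeasure_fixed_inter_le_mul`): for `Λ ⊆ Λ'`, `A` measurable with
`μ^ζ_{Λ;β,h}(A) ≤ ε` for every boundary condition `ζ` *agreeing with `η` off `Λ'`*, and `B`
measurable and determined by the spins off `Λ`, `μ^η_{Λ';β,h}(A ∩ B) ≤ ε · μ^η_{Λ';β,h}(B)`.
[cite: FriedliVelenik2017, Lemma 6.7] -/
theorem isingMeasure_fixed_inter_le_mul_of_support {Λ Λ' : Finset V} (hsub : Λ ⊆ Λ') (β h : ℝ)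
    (η : SpinConfig V) {A B : Set (SpinConfig V)} (hA : MeasurableSet A) (hB : MeasurableSet B)
    (hBdet : ∀ σ₁ σ₂ : SpinConfig V, (∀ x ∉ Λ, σ₁ x = σ₂ x) → (σ₁ ∈ B ↔ σ₂ ∈ B))
    {ε : ENNReal} (hε : ∀ ζ : SpinConfig V, (∀ x ∉ Λ', ζ x = η x) → isingMeasure G Λ β h (.fixed ζ) A ≤ ε) :
    isingMeasure G Λ' β h (.fixed η) (A ∩ B) ≤ ε * isingMeasure G Λ' β h (.fixed η) B := by
  rw [← lintegral_isingMeasure_fixed_consistent G hsub β h η (hA.inter hB)]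
  simp_rw [isingMeasure_fixed_inter_of_determined_off G Λ β h _ hA hB hBdet]
  have hae := ae_eqOn_compl_isingMeasure_fixed G Λ' β h η
  calc ∫⁻ σ, B.indicator (fun _ ↦ isingMeasure G Λ β h (.fixed σ) A) σ ∂isingMeasure G Λ' β h (.fixed η)
      ≤ ∫⁻ σ, B.indicator (fun _ ↦ ε) σ ∂isingMeasure G Λ' β h (.fixed η) := by
        refine lintegral_mono_ae (hae.mono fun σ hσ ↦ ?_)
        show B.indicator _ σ ≤ B.indicator _ σ
        by_cases hσB : σ ∈ B
        · rw [Set.indicator_of_mem hσB, Set.indicator_of_mem hσB]; exact hε σ hσ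
        · rw [Set.indicator_of_notMem hσB, Set.indicator_of_notMem hσB]
    _ = ε * isingMeasure G Λ' β h (.fixed η) B := lintegral_indicator_const hB ε

end Cylinder

/-! ### Local `+` paths, crossings and arms in a region -/

section Region

variable {V : Type*} (G : SimpleGraph V)

/-- The graph of **local `+` paths** of the configuration `σ` in the region `U` (a set of sites):
`x ∼ y` iff `x ∼ y` in `G`, both lie in `U` and both carry spin `+1`. Its connected components
through `+` sites are the local `+` clusters of the region. (KS 2017, Rem. 2.10: clusters of one
colour; DCS 2012, §6.1: paths "in the annulus".) [cite: KemppainenSmirnov2017, Rem. 2.10] -/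
def plusGraph (U : Finset V) (σ : SpinConfig V) : SimpleGraph V where
  Adj x y := G.Adj x y ∧ x ∈ U ∧ y ∈ U ∧ σ x = 1 ∧ σ y = 1
  symm := ⟨fun _ _ h ↦ ⟨h.1.symm, h.2.2.1, h.2.1, h.2.2.2.2, h.2.2.2.1⟩⟩
  loopless := ⟨fun _ h ↦ G.irrefl h.1⟩

variable {G}

/-- Adjacency in the `+` graph, unfolded. [folklore] -/
theorem plusGraph_adj {U : Finset V} {σ : SpinConfig V} {x y : V} :
    (plusGraph G U σ).Adj x y ↔ G.Adj x y ∧ x ∈ U ∧ y ∈ U ∧ σ x = 1 ∧ σ y = 1 := Iff.rfl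

/-- The `+` graph is monotone in the region. [folklore] -/
theorem plusGraph_mono_left {U U' : Finset V} (h : U' ⊆ U) (σ : SpinConfig V) :
    plusGraph G U' σ ≤ plusGraph G U σ :=
  fun _ _ hxy ↦ ⟨hxy.1, h hxy.2.1, h hxy.2.2.1, hxy.2.2.2.1, hxy.2.2.2.2⟩

/-- The `+` graph is monotone in the configuration. [folklore] -/
theorem plusGraph_mono {U : Finset V} {σ₁ σ₂ : SpinConfig V} (h : σ₁ ≤ σ₂) :
    plusGraph G U σ₁ ≤ plusGraph G U σ₂ := by
  intro x y hxy
  refine ⟨hxy.1, hxy.2.1, hxy.2.2.1, ?_, ?_⟩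
  · exact le_antisymm (intUnits_le_one _) (hxy.2.2.2.1 ▸ h x)
  · exact le_antisymm (intUnits_le_one _) (hxy.2.2.2.2 ▸ h y)

/-- The `+` graph only depends on the spins of the region. [folklore] -/
theorem plusGraph_eq_of_agree {U : Finset V} {σ₁ σ₂ : SpinConfig V} (h : ∀ x ∈ U, σ₁ x = σ₂ x) :
    plusGraph G U σ₁ = plusGraph G U σ₂ := by
  ext x y
  simp only [plusGraph_adj]
  constructor
  · rintro ⟨h1, hx, hy, h2, h3⟩; exact ⟨h1, hx, hy, (h x hx) ▸ h2, (h y hy) ▸ h3⟩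
  · rintro ⟨h1, hx, hy, h2, h3⟩; exact ⟨h1, hx, hy, (h x hx).symm ▸ h2, (h y hy).symm ▸ h3⟩

/-- A vertex locally `+`-reachable from a `+` vertex of `U` is a `+` vertex of `U`. [folklore] -/
theorem mem_and_eq_one_of_reachable {U : Finset V} {σ : SpinConfig V} {a v : V} (ha : a ∈ U)
    (ha1 : σ a = 1) (h : (plusGraph G U σ).Reachable a v) : v ∈ U ∧ σ v = 1 :=
  (reachable_invariant (A := plusGraph G U σ) (B := plusGraph G U σ) (P := fun v ↦ v ∈ U ∧ σ v = 1)
    (fun _ _ huv _ ↦ ⟨⟨huv.2.2.1, huv.2.2.2.2⟩, huv⟩) ⟨ha, ha1⟩ h).1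

variable (G)

/-- **One local `+` crossing**: some `+` vertex of `In ∩ U` is joined to some vertex of `Out` by a
path of `+` vertices of `U` (KS 2017, Rem. 2.10, the crossing event of one colour; DCS 2012, §6.1).
[cite: KemppainenSmirnov2017, Rem. 2.10] -/
def plusCrossing (U : Finset V) (In Out : Finset V) : Set (SpinConfig V) :=
  {σ | ∃ a ∈ In, a ∈ U ∧ σ a = 1 ∧ ∃ b ∈ Out, (plusGraph G U σ).Reachable a b}

/-- **`j` separated local `+` crossings** ("`j` arms in distinct local clusters"): `j` `+` vertices
of `In ∩ U`, each locally joined to `Out`, pairwise NOT locally joined. (DCS 2012, §6.1, the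
crossing-cluster form of "`k` paths" produced by the sector argument of Aizenman–Burchard 1999,
App. A.) [cite: DuminilCopinSmirnov2012Clay, §6.1, proof of Thm. 6.1] -/
def plusArms (U : Finset V) (In Out : Finset V) (j : ℕ) : Set (SpinConfig V) :=
  {σ | ∃ s : Finset V, s.card = j ∧
    (∀ a ∈ s, a ∈ In ∧ a ∈ U ∧ σ a = 1 ∧ ∃ b ∈ Out, (plusGraph G U σ).Reachable a b) ∧
    (↑s : Set V).Pairwise fun a a' ↦ ¬ (plusGraph G U σ).Reachable a a'}

/-- **`j` separated local `+` crossings avoiding an exceptional seed set `Z`**: as `plusArms`, the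
`j` crossing clusters being in addition not locally joined to any vertex of `Z` (for interfaces in
a Dobrushin domain: arms in sectors free of the `+` boundary arc).
[cite: DuminilCopinSmirnov2012Clay, §6.1, proof of Thm. 6.1] -/
def plusArmsAvoiding (U : Finset V) (In Out Z : Finset V) (j : ℕ) : Set (SpinConfig V) :=
  {σ | ∃ s : Finset V, s.card = j ∧
    (∀ a ∈ s, a ∈ In ∧ a ∈ U ∧ σ a = 1 ∧ ∃ b ∈ Out, (plusGraph G U σ).Reachable a b) ∧
    (∀ a ∈ s, ∀ z ∈ Z, ¬ (plusGraph G U σ).Reachable a z) ∧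
    (↑s : Set V).Pairwise fun a a' ↦ ¬ (plusGraph G U σ).Reachable a a'}

/-- The **insulation invariant**: every vertex of the insulating set `T₀` outside the region `U`
but adjacent to it carries boundary spin `−1` (the revealed frontier of the explored `+` clusters,
and the `−` boundary arc). Preserved when an explored `+` cluster and its `−` frontier are removed
from the region (`plusInsulated_explore`). [cite: DuminilCopinSmirnov2012Clay, §6.1, proof of Thm. 6.1] -/
def PlusInsulated (T₀ : Set V) (U : Finset V) (ξ : SpinConfig V) : Prop :=
  ∀ v ∈ T₀, v ∉ U → (∃ u ∈ U, G.Adj u v) → ξ v = -1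

variable {G}

/-- One crossing is an increasing event. [folklore] -/
theorem isUpperSet_plusCrossing (U In Out : Finset V) : IsUpperSet (plusCrossing G U In Out) := by
  rintro σ₁ σ₂ hle ⟨a, ha, haU, ha1, b, hb, hab⟩
  exact ⟨a, ha, haU, le_antisymm (intUnits_le_one _) (ha1 ▸ hle a), b, hb, hab.mono (plusGraph_mono hle)⟩

/-- `j ≥ 1` separated crossings give one crossing. [folklore] -/
theorem plusArms_subset_plusCrossing (U In Out : Finset V) {j : ℕ} (hj : 1 ≤ j) :
    plusArms G U In Out j ⊆ plusCrossing G U In Out := by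
  rintro σ ⟨s, hcard, hcross, -⟩
  obtain ⟨a, ha⟩ : s.Nonempty := Finset.card_pos.1 (hcard ▸ hj)
  obtain ⟨haIn, haU, ha1, b, hb, hab⟩ := hcross a ha
  exact ⟨a, haIn, haU, ha1, b, hb, hab⟩

/-- `plusCrossing` is determined by the spins of the region. [folklore] -/
theorem plusCrossing_determined (U In Out : Finset V) (σ₁ σ₂ : SpinConfig V) (h : ∀ x ∈ U, σ₁ x = σ₂ x) :
    σ₁ ∈ plusCrossing G U In Out ↔ σ₂ ∈ plusCrossing G U In Out := by
  simp only [plusCrossing, Set.mem_setOf_eq, plusGraph_eq_of_agree h]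
  constructor
  · rintro ⟨a, ha, haU, ha1, hb⟩; exact ⟨a, ha, haU, (h a haU) ▸ ha1, hb⟩
  · rintro ⟨a, ha, haU, ha1, hb⟩; exact ⟨a, ha, haU, (h a haU).symm ▸ ha1, hb⟩

/-- `plusArms` is determined by the spins of the region. [folklore] -/
theorem plusArms_determined (U In Out : Finset V) (j : ℕ) (σ₁ σ₂ : SpinConfig V) (h : ∀ x ∈ U, σ₁ x = σ₂ x) :
    σ₁ ∈ plusArms G U In Out j ↔ σ₂ ∈ plusArms G U In Out j := by
  simp only [plusArms, Set.mem_setOf_eq, plusGraph_eq_of_agree h]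
  constructor
  · rintro ⟨s, hc, hcross, hsep⟩
    exact ⟨s, hc, fun a ha ↦ by
      obtain ⟨h1, h2, h3, h4⟩ := hcross a ha; exact ⟨h1, h2, (h a h2) ▸ h3, h4⟩, hsep⟩
  · rintro ⟨s, hc, hcross, hsep⟩
    exact ⟨s, hc, fun a ha ↦ by
      obtain ⟨h1, h2, h3, h4⟩ := hcross a ha; exact ⟨h1, h2, (h a h2).symm ▸ h3, h4⟩, hsep⟩

/-- `plusArmsAvoiding` is determined by the spins of the region. [folklore] -/
theorem plusArmsAvoiding_determined (U In Out Z : Finset V) (j : ℕ) (σ₁ σ₂ : SpinConfig V)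
    (h : ∀ x ∈ U, σ₁ x = σ₂ x) :
    σ₁ ∈ plusArmsAvoiding G U In Out Z j ↔ σ₂ ∈ plusArmsAvoiding G U In Out Z j := by
  simp only [plusArmsAvoiding, Set.mem_setOf_eq, plusGraph_eq_of_agree h]
  constructor
  · rintro ⟨s, hc, hcross, hZ, hsep⟩
    exact ⟨s, hc, fun a ha ↦ by
      obtain ⟨h1, h2, h3, h4⟩ := hcross a ha; exact ⟨h1, h2, (h a h2) ▸ h3, h4⟩, hZ, hsep⟩
  · rintro ⟨s, hc, hcross, hZ, hsep⟩
    exact ⟨s, hc, fun a ha ↦ by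
      obtain ⟨h1, h2, h3, h4⟩ := hcross a ha; exact ⟨h1, h2, (h a h2).symm ▸ h3, h4⟩, hZ, hsep⟩

/-- `plusCrossing` is measurable. [folklore] -/
theorem measurableSet_plusCrossing (U In Out : Finset V) : MeasurableSet (plusCrossing G U In Out) :=
  measurableSet_of_determined U (plusCrossing_determined U In Out)

/-- `plusArms` is measurable. [folklore] -/
theorem measurableSet_plusArms (U In Out : Finset V) (j : ℕ) : MeasurableSet (plusArms G U In Out j) :=
  measurableSet_of_determined U (plusArms_determined U In Out j)

/-- `plusArmsAvoiding` is measurable. [folklore] -/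
theorem measurableSet_plusArmsAvoiding (U In Out Z : Finset V) (j : ℕ) :
    MeasurableSet (plusArmsAvoiding G U In Out Z j) :=
  measurableSet_of_determined U (plusArmsAvoiding_determined U In Out Z j)

/-! ### Local clusters: frontier, closedness and what survives off them -/

variable (G) [DecidableEq V]

open scoped Classical in
/-- The **frontier** in `U` of a vertex set `K`: the vertices of `U ∖ K` adjacent in `G` to a vertex
of `K`. For a local `+` cluster `K` these vertices carry spin `−1`. [folklore] -/
def frontierIn (U K : Finset V) : Finset V := U.filter fun v ↦ v ∉ K ∧ ∃ u ∈ K, G.Adj u v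

variable {G}

/-- Membership in the frontier. [folklore] -/
theorem mem_frontierIn {U K : Finset V} {v : V} :
    v ∈ frontierIn G U K ↔ v ∈ U ∧ v ∉ K ∧ ∃ u ∈ K, G.Adj u v := by
  classical
  rw [frontierIn, Finset.mem_filter]

/-- The frontier lies in the region. [folklore] -/
theorem frontierIn_subset (U K : Finset V) : frontierIn G U K ⊆ U := fun _ h ↦ (mem_frontierIn.1 h).1

/-- The frontier misses the set. [folklore] -/
theorem disjoint_frontierIn (U K : Finset V) : Disjoint K (frontierIn G U K) :=
  Finset.disjoint_right.2 fun _ hv hvK ↦ (mem_frontierIn.1 hv).2.1 hvK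

/-- The **revealed pattern** of an explored cluster `K`: `+1` on `K`, `−1` elsewhere (used on the
frontier). [folklore] -/
def clusterPattern (K : Finset V) : SpinConfig V := fun v ↦ if v ∈ K then 1 else -1

/-- **Structure of a union of local `+` clusters.** If `K` is the set of vertices locally
`+`-reachable in `(U, σ)` from a set `Z'` of `+` vertices of `U`, then `K ⊆ U`, `σ = +1` on `K`,
`σ = −1` on the frontier of `K`, and `K` is closed under local `+` adjacency. [folklore] -/
theorem plusSeedCluster_spec {U K : Finset V} {σ : SpinConfig V} {Z' : Set V} (hZ' : ∀ z ∈ Z', z ∈ U ∧ σ z = 1)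
    (hK : ∀ v, v ∈ K ↔ ∃ z ∈ Z', (plusGraph G U σ).Reachable z v) :
    K ⊆ U ∧ (∀ v ∈ K, σ v = 1) ∧ (∀ v ∈ frontierIn G U K, σ v = -1) ∧
      (∀ ⦃u v : V⦄, (plusGraph G U σ).Adj u v → u ∈ K → v ∈ K) := by
  have hmem : ∀ v ∈ K, v ∈ U ∧ σ v = 1 := fun v hv ↦ by
    obtain ⟨z, hz, hzv⟩ := (hK v).1 hv
    exact mem_and_eq_one_of_reachable (hZ' z hz).1 (hZ' z hz).2 hzv
  have hcl : ∀ ⦃u v : V⦄, (plusGraph G U σ).Adj u v → u ∈ K → v ∈ K := fun u v huv hu ↦ by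
    obtain ⟨z, hz, hzu⟩ := (hK u).1 hu
    exact (hK v).2 ⟨z, hz, hzu.trans huv.reachable⟩
  refine ⟨fun v hv ↦ (hmem v hv).1, fun v hv ↦ (hmem v hv).2, fun v hv ↦ ?_, hcl⟩
  obtain ⟨hvU, hvK, u, huK, huv⟩ := mem_frontierIn.1 hv
  rcases Int.units_eq_one_or (σ v) with h1 | h1
  · exact absurd (hcl ⟨huv, (hmem u huK).1, hvU, (hmem u huK).2, h1⟩ huK) hvK
  · exact h1

/-- **Structure of a local `+` cluster.** If `K` is the set of vertices locally `+`-reachable in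
`(U, σ)` from a `+` vertex `a ∈ U`, then `K ⊆ U`, `σ = +1` on `K`, `σ = −1` on the frontier of
`K`, and `K` is closed under local `+` adjacency. [folklore] -/
theorem cluster_spec {U K : Finset V} {σ : SpinConfig V} {a : V} (ha : a ∈ U) (ha1 : σ a = 1)
    (hK : ∀ v, v ∈ K ↔ (plusGraph G U σ).Reachable a v) :
    K ⊆ U ∧ (∀ v ∈ K, σ v = 1) ∧ (∀ v ∈ frontierIn G U K, σ v = -1) ∧
      (∀ ⦃u v : V⦄, (plusGraph G U σ).Adj u v → u ∈ K → v ∈ K) :=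
  plusSeedCluster_spec (Z' := {a}) (by simpa using And.intro ha ha1) fun v ↦ by simpa using hK v

/-- **A configuration with the revealed spins has the same clusters.** If `K` is the union of the
local `+` clusters in `(U, σ₀)` of a set `Z'` of `+` vertices of `U`, and `σ` is `+1` on `K` and
`−1` on its frontier, then the union of the local `+` clusters of `Z'` in `(U, σ)` is again `K`.
[folklore] -/
theorem plusSeedReachable_iff_of_pattern {U K : Finset V} {σ₀ σ : SpinConfig V} {Z' : Set V}
    (hZ' : ∀ z ∈ Z', z ∈ U ∧ σ₀ z = 1) (hK : ∀ v, v ∈ K ↔ ∃ z ∈ Z', (plusGraph G U σ₀).Reachable z v)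
    (hplus : ∀ v ∈ K, σ v = 1) (hminus : ∀ v ∈ frontierIn G U K, σ v = -1) (v : V) :
    (∃ z ∈ Z', (plusGraph G U σ).Reachable z v) ↔ v ∈ K := by
  obtain ⟨hKU, hK1, -, hcl⟩ := plusSeedCluster_spec hZ' hK
  have hZK : ∀ z ∈ Z', z ∈ K := fun z hz ↦ (hK z).2 ⟨z, hz, Reachable.refl _⟩
  constructor
  · rintro ⟨z, hz, h⟩
    refine (reachable_invariant (A := plusGraph G U σ) (B := plusGraph G U σ) (P := (· ∈ K))
      (fun u w huw hu ↦ ⟨?_, huw⟩) (hZK z hz) h).1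
    by_contra hw
    have hwF : w ∈ frontierIn G U K := mem_frontierIn.2 ⟨huw.2.2.1, hw, u, hu, huw.1⟩
    have := hminus w hwF
    rw [huw.2.2.2.2] at this
    exact absurd this (by decide)
  · intro hv
    obtain ⟨z, hz, h₀⟩ := (hK v).1 hv
    exact ⟨z, hz, (reachable_invariant (A := plusGraph G U σ₀) (B := plusGraph G U σ) (P := (· ∈ K))
      (fun u w huw hu ↦ ⟨hcl huw hu, huw.1, huw.2.1, huw.2.2.1, hplus u hu, hplus w (hcl huw hu)⟩) (hZK z hz) h₀).2⟩

/-- **A configuration with the revealed spins has the same cluster.** If `K` is the local `+`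
cluster of `a` in `(U, σ₀)` (`a ∈ U`, `σ₀ a = 1`) and `σ` is `+1` on `K` and `−1` on its frontier,
then the local `+` cluster of `a` in `(U, σ)` is again `K`. [folklore] -/
theorem reachable_iff_of_pattern {U K : Finset V} {σ₀ σ : SpinConfig V} {a : V} (ha : a ∈ U) (ha1 : σ₀ a = 1)
    (hK : ∀ v, v ∈ K ↔ (plusGraph G U σ₀).Reachable a v)
    (hplus : ∀ v ∈ K, σ v = 1) (hminus : ∀ v ∈ frontierIn G U K, σ v = -1) (v : V) :
    (plusGraph G U σ).Reachable a v ↔ v ∈ K := by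
  have := plusSeedReachable_iff_of_pattern (Z' := {a}) (by simpa using And.intro ha ha1)
    (fun v ↦ by simpa using hK v) hplus hminus v
  simpa using this

/-- **Removing `−` sites from the region does not change the `+` graph.** [folklore] -/
theorem plusGraph_sdiff_eq_of_minus {U N : Finset V} {σ : SpinConfig V} (hN : ∀ v ∈ N, v ∈ U → σ v = -1) :
    plusGraph G (U \ N) σ = plusGraph G U σ := by
  ext x y
  simp only [plusGraph_adj, Finset.mem_sdiff]
  constructor
  · rintro ⟨h1, ⟨hx, -⟩, ⟨hy, -⟩, h2, h3⟩; exact ⟨h1, hx, hy, h2, h3⟩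
  · rintro ⟨h1, hx, hy, h2, h3⟩
    refine ⟨h1, ⟨hx, fun hxN ↦ ?_⟩, ⟨hy, fun hyN ↦ ?_⟩, h2, h3⟩
    · have := hN x hxN hx; rw [h2] at this; exact absurd this (by decide)
    · have := hN y hyN hy; rw [h3] at this; exact absurd this (by decide)

/-- **Off an explored cluster, local `+` paths live in the smaller region.** If `σ = −1` on the
frontier of `K ⊆ U` and every local `+` edge leaving a vertex of `K` stays in `K`, then for
`x ∉ K` (and `x` off the frontier) local `+` reachability in `U` from `x` coincides with local `+`
reachability in `U ∖ (K ∪ frontier)`, and never reaches `K`. [folklore] -/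
theorem reachable_sdiff_iff {U K : Finset V} {σ : SpinConfig V}
    (hminus : ∀ v ∈ frontierIn G U K, σ v = -1) {x : V} (hx : x ∉ K) (hxF : x ∉ frontierIn G U K) (y : V) :
    (plusGraph G U σ).Reachable x y ↔ (plusGraph G (U \ (K ∪ frontierIn G U K)) σ).Reachable x y := by
  refine ⟨fun h ↦ ?_, fun h ↦ h.mono (plusGraph_mono_left Finset.sdiff_subset σ)⟩
  have key := reachable_invariant (A := plusGraph G U σ) (B := plusGraph G (U \ (K ∪ frontierIn G U K)) σ)
    (P := fun v ↦ v ∉ K ∧ v ∉ frontierIn G U K) (fun u w huw hu ↦ ?_) ⟨hx, hxF⟩ h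
  · exact key.2
  · obtain ⟨hG, huU, hwU, hu1, hw1⟩ := huw
    have hwF : w ∉ frontierIn G U K := fun hwF ↦ by
      have := hminus w hwF; rw [hw1] at this; exact absurd this (by decide)
    have hwK : w ∉ K := fun hwK ↦ by
      -- then `u` is on the frontier (it is adjacent to `w ∈ K`, in `U`, off `K`)
      exact hu.2 (mem_frontierIn.2 ⟨huU, hu.1, w, hwK, hG.symm⟩)
    refine ⟨⟨hwK, hwF⟩, hG, ?_, ?_, hu1, hw1⟩
    · exact Finset.mem_sdiff.2 ⟨huU, fun h' ↦ by rcases Finset.mem_union.1 h' with h' | h' <;> [exact hu.1 h'; exact hu.2 h']⟩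
    · exact Finset.mem_sdiff.2 ⟨hwU, fun h' ↦ by rcases Finset.mem_union.1 h' with h' | h' <;> [exact hwK h'; exact hwF h']⟩

/-- A vertex locally `+`-reachable (in `U`) from outside `K ∪ frontier` is outside `K`. [folklore] -/
theorem not_mem_of_reachable_sdiff {U K : Finset V} {σ : SpinConfig V}
    (hminus : ∀ v ∈ frontierIn G U K, σ v = -1) {x : V} (hx : x ∉ K) (hxF : x ∉ frontierIn G U K) {y : V}
    (h : (plusGraph G U σ).Reachable x y) : y ∉ K :=
  (reachable_invariant (A := plusGraph G (U \ (K ∪ frontierIn G U K)) σ)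
    (B := plusGraph G (U \ (K ∪ frontierIn G U K)) σ) (P := (· ∉ K))
    (fun _ _ huw _ ↦ ⟨fun hwK ↦ (Finset.mem_sdiff.1 huw.2.2.1).2 (Finset.mem_union_left _ hwK), huw⟩) hx
    ((reachable_sdiff_iff hminus hx hxF y).1 h)).1

end Region

/-! ### The exploration of the first crossing cluster -/

section Exploration

variable {V : Type*} (G : SimpleGraph V)

/-- `a` is a **`+` crossing vertex** of `(U, σ)` towards `Out`: a `+` vertex of `U` locally joined
to a vertex of `Out`. [folklore] -/
def IsPlusCrosser (U Out : Finset V) (σ : SpinConfig V) (a : V) : Prop :=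
  a ∈ U ∧ σ a = 1 ∧ ∃ b ∈ Out, (plusGraph G U σ).Reachable a b

open scoped Classical in
/-- The `+` crossing vertices of `In`. [folklore] -/
def plusCrossers (U In Out : Finset V) (σ : SpinConfig V) : Finset V := In.filter fun a ↦ IsPlusCrosser G U Out σ a

variable {G}

/-- Membership in `plusCrossers`. [folklore] -/
theorem mem_plusCrossers {U In Out : Finset V} {σ : SpinConfig V} {a : V} :
    a ∈ plusCrossers G U In Out σ ↔ a ∈ In ∧ IsPlusCrosser G U Out σ a := by
  classical
  rw [plusCrossers, Finset.mem_filter]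

/-- Being a crossing vertex is monotone in the configuration. [folklore] -/
theorem IsPlusCrosser.mono {U Out : Finset V} {σ₁ σ₂ : SpinConfig V} (hle : σ₁ ≤ σ₂) {a : V}
    (h : IsPlusCrosser G U Out σ₁ a) : IsPlusCrosser G U Out σ₂ a :=
  ⟨h.1, le_antisymm (intUnits_le_one _) (h.2.1 ▸ hle a), h.2.2.imp fun _ hb ↦ ⟨hb.1, hb.2.mono (plusGraph_mono hle)⟩⟩

/-- Being a crossing vertex is monotone in the region. [folklore] -/
theorem IsPlusCrosser.mono_left {U U' Out : Finset V} (hU : U' ⊆ U) {σ : SpinConfig V} {a : V}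
    (h : IsPlusCrosser G U' Out σ a) : IsPlusCrosser G U Out σ a :=
  ⟨hU h.1, h.2.1, h.2.2.imp fun _ hb ↦ ⟨hb.1, hb.2.mono (plusGraph_mono_left hU σ)⟩⟩

/-- Being a crossing vertex only depends on the spins of the region. [folklore] -/
theorem isPlusCrosser_congr {U Out : Finset V} {σ₁ σ₂ : SpinConfig V} (h : ∀ x ∈ U, σ₁ x = σ₂ x) (a : V) :
    IsPlusCrosser G U Out σ₁ a ↔ IsPlusCrosser G U Out σ₂ a := by
  simp only [IsPlusCrosser, plusGraph_eq_of_agree h]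
  constructor
  · rintro ⟨haU, ha1, hb⟩; exact ⟨haU, (h a haU) ▸ ha1, hb⟩
  · rintro ⟨haU, ha1, hb⟩; exact ⟨haU, (h a haU).symm ▸ ha1, hb⟩

/-- `plusCrossers` only depends on the spins of the region. [folklore] -/
theorem plusCrossers_congr {U In Out : Finset V} {σ₁ σ₂ : SpinConfig V} (h : ∀ x ∈ U, σ₁ x = σ₂ x) :
    plusCrossers G U In Out σ₁ = plusCrossers G U In Out σ₂ := by
  ext a
  rw [mem_plusCrossers, mem_plusCrossers, isPlusCrosser_congr h]

/-- `plusCrossing` in terms of crossing vertices. [folklore] -/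
theorem mem_plusCrossing_iff {U In Out : Finset V} {σ : SpinConfig V} :
    σ ∈ plusCrossing G U In Out ↔ ∃ a ∈ In, IsPlusCrosser G U Out σ a := Iff.rfl

variable (G) [LinearOrder V]

open scoped Classical in
/-- The **explored cluster**: the local `+` cluster in `(U, σ)` of the least `+` crossing vertex of
`In` (for a fixed linear order of the vertices), or `∅` if there is none. This replaces the
"right-most crossing" of the planar argument (DCS 2012, §6.1). [cite: DuminilCopinSmirnov2012Clay, §6.1, proof of Thm. 6.1] -/
def explPlusCluster (U In Out : Finset V) (σ : SpinConfig V) : Finset V :=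
  if h : (plusCrossers G U In Out σ).Nonempty then
    U.filter fun v ↦ (plusGraph G U σ).Reachable ((plusCrossers G U In Out σ).min' h) v
  else ∅

variable {G} {U In Out : Finset V}

/-- With a crossing vertex, the explored cluster is the local `+` cluster of the least one. [folklore] -/
theorem mem_explPlusCluster_iff {σ : SpinConfig V} (h : (plusCrossers G U In Out σ).Nonempty) (v : V) :
    v ∈ explPlusCluster G U In Out σ ↔ (plusGraph G U σ).Reachable ((plusCrossers G U In Out σ).min' h) v := by
  classical
  rw [explPlusCluster, dif_pos h, Finset.mem_filter, and_iff_right_iff_imp]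
  intro hr
  obtain ⟨-, haU, ha1, -⟩ := mem_plusCrossers.1 (Finset.min'_mem _ h)
  exact (mem_and_eq_one_of_reachable haU ha1 hr).1

/-- The explored cluster lies in the region. [folklore] -/
theorem explPlusCluster_subset (σ : SpinConfig V) : explPlusCluster G U In Out σ ⊆ U := by
  classical
  unfold explPlusCluster
  split_ifs
  · exact Finset.filter_subset _ _
  · exact Finset.empty_subset _

/-- The explored cluster only depends on the spins of the region. [folklore] -/
theorem explPlusCluster_congr {σ₁ σ₂ : SpinConfig V} (h : ∀ x ∈ U, σ₁ x = σ₂ x) :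
    explPlusCluster G U In Out σ₁ = explPlusCluster G U In Out σ₂ := by
  classical
  unfold explPlusCluster
  simp only [plusCrossers_congr h, plusGraph_eq_of_agree h]

/-- **Structure of the explored cluster** of a configuration with a crossing vertex: with `a` the
least crossing vertex and `K` the explored cluster, `a ∈ In`, `a ∈ U`, `σ a = +1`, `K` meets `Out`,
`K` is the set of vertices locally `+`-reachable from `a`, and every vertex of `In` in `K` is
`≥ a`. [folklore] -/
theorem explPlusCluster_spec {σ : SpinConfig V} (h : (plusCrossers G U In Out σ).Nonempty) :
    (plusCrossers G U In Out σ).min' h ∈ In ∧ (plusCrossers G U In Out σ).min' h ∈ U ∧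
    σ ((plusCrossers G U In Out σ).min' h) = 1 ∧
    (∃ b ∈ Out, b ∈ explPlusCluster G U In Out σ) ∧
    (∀ v, v ∈ explPlusCluster G U In Out σ ↔ (plusGraph G U σ).Reachable ((plusCrossers G U In Out σ).min' h) v) ∧
    (∀ a' ∈ In, a' ∈ explPlusCluster G U In Out σ → (plusCrossers G U In Out σ).min' h ≤ a') := by
  set a := (plusCrossers G U In Out σ).min' h with ha
  obtain ⟨haIn, haU, ha1, b, hb, hab⟩ := mem_plusCrossers.1 (Finset.min'_mem _ h)
  refine ⟨haIn, haU, ha1, ⟨b, hb, (mem_explPlusCluster_iff h b).2 hab⟩, mem_explPlusCluster_iff h,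
    fun a' ha'In ha'K ↦ ?_⟩
  have hr := (mem_explPlusCluster_iff h a').1 ha'K
  obtain ⟨ha'U, ha'1⟩ := mem_and_eq_one_of_reachable haU ha1 hr
  exact Finset.min'_le _ _ (mem_plusCrossers.2 ⟨ha'In, ha'U, ha'1, b, hb, hr.symm.trans hab⟩)

/-- **The least crossing vertex of a configuration with prescribed explored cluster.** If the
explored cluster of `σ` is `K`, that of `σ₀` is `K` as well (both with a crossing vertex), then
their least crossing vertices coincide. [folklore] -/
theorem min'_plusCrossers_eq {σ₀ σ : SpinConfig V} (h₀ : (plusCrossers G U In Out σ₀).Nonempty)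
    (h : (plusCrossers G U In Out σ).Nonempty)
    (hK : explPlusCluster G U In Out σ = explPlusCluster G U In Out σ₀) :
    (plusCrossers G U In Out σ).min' h = (plusCrossers G U In Out σ₀).min' h₀ := by
  obtain ⟨haIn, haU, ha1, ⟨b, hb, hbK⟩, hKreach, hmin⟩ := explPlusCluster_spec h₀
  obtain ⟨haIn', haU', ha1', -, hKreach', hmin'⟩ := explPlusCluster_spec h
  set a := (plusCrossers G U In Out σ₀).min' h₀
  set a' := (plusCrossers G U In Out σ).min' h
  refine le_antisymm ?_ (hmin _ haIn' (hK ▸ (hKreach' a').2 (Reachable.refl _)))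
  -- `a` crosses in `σ`: it lies in the explored cluster of `σ`, which contains `b ∈ Out`
  have haK : a ∈ explPlusCluster G U In Out σ := hK ▸ (hKreach a).2 (Reachable.refl _)
  have hbK' : b ∈ explPlusCluster G U In Out σ := hK ▸ hbK
  have hra := (hKreach' a).1 haK
  have hrb := (hKreach' b).1 hbK'
  obtain ⟨haUσ, ha1σ⟩ := mem_and_eq_one_of_reachable haU' ha1' hra
  exact Finset.min'_le _ _ (mem_plusCrossers.2 ⟨haIn, haUσ, ha1σ, b, hb, hra.symm.trans hrb⟩)

variable [DecidableEq V]

/-- **The fibre of the explored cluster, from inside.** Let `σ₀` have a crossing vertex, least one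
`a`, explored cluster `K`. If `σ` is `+1` on `K`, `−1` on the frontier of `K` in `U`, and no vertex
of `In` below `a` is a crossing vertex of the smaller region `U ∖ (K ∪ frontier)`, then `σ` has a
crossing vertex and the same explored cluster `K`. [folklore] -/
theorem explPlusCluster_eq_of_pattern {σ₀ σ : SpinConfig V} (h₀ : (plusCrossers G U In Out σ₀).Nonempty)
    (hplus : ∀ v ∈ explPlusCluster G U In Out σ₀, σ v = 1)
    (hminus : ∀ v ∈ frontierIn G U (explPlusCluster G U In Out σ₀), σ v = -1)
    (hbelow : ∀ a' ∈ In, a' < (plusCrossers G U In Out σ₀).min' h₀ →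
      ¬ IsPlusCrosser G (U \ (explPlusCluster G U In Out σ₀ ∪ frontierIn G U (explPlusCluster G U In Out σ₀))) Out σ a') :
    (plusCrossers G U In Out σ).Nonempty ∧ explPlusCluster G U In Out σ = explPlusCluster G U In Out σ₀ := by
  set a := (plusCrossers G U In Out σ₀).min' h₀ with ha
  set K := explPlusCluster G U In Out σ₀ with hKdef
  obtain ⟨haIn, haU, ha1, ⟨b, hb, hbK⟩, hKreach, hmin⟩ := explPlusCluster_spec h₀
  have haK : a ∈ K := (hKreach a).2 (Reachable.refl _)
  -- the `σ`-cluster of `a` is `K`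
  have hreach : ∀ v, (plusGraph G U σ).Reachable a v ↔ v ∈ K :=
    reachable_iff_of_pattern haU ha1 hKreach hplus hminus
  -- `a` crosses in `σ`
  have hacross : a ∈ plusCrossers G U In Out σ :=
    mem_plusCrossers.2 ⟨haIn, haU, hplus a haK, b, hb, (hreach b).2 hbK⟩
  have hne : (plusCrossers G U In Out σ).Nonempty := ⟨a, hacross⟩
  -- and is the least crossing vertex of `σ`
  have hmin' : (plusCrossers G U In Out σ).min' hne = a := by
    refine le_antisymm (Finset.min'_le _ _ hacross) (Finset.le_min' _ _ _ fun a' ha' ↦ ?_)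
    obtain ⟨ha'In, ha'U, ha'1, b', hb', ha'b'⟩ := mem_plusCrossers.1 ha'
    by_cases ha'K : a' ∈ K
    · exact hmin a' ha'In ha'K
    · by_contra hlt
      push Not at hlt
      have ha'F : a' ∉ frontierIn G U K := fun h' ↦ by
        have := hminus a' h'; rw [ha'1] at this; exact absurd this (by decide)
      refine hbelow a' ha'In hlt ⟨Finset.mem_sdiff.2 ⟨ha'U, ?_⟩, ha'1, b', hb',
        (reachable_sdiff_iff hminus ha'K ha'F b').1 ha'b'⟩
      intro h'
      rcases Finset.mem_union.1 h' with h' | h'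
      · exact ha'K h'
      · exact ha'F h'
  refine ⟨hne, ?_⟩
  ext v
  rw [mem_explPlusCluster_iff hne, hmin', hreach]

end Exploration

/-! ### The measure-theoretic induction -/

section Main

variable {V : Type*} (G : SimpleGraph V) [DecidableEq V] [G.LocallyFinite] [Countable V] [LinearOrder V]

omit [G.LocallyFinite] [Countable V] [LinearOrder V] in
/-- **The insulation invariant survives the exploration of a `+` cluster**: removing `K` and its
frontier from the region and imposing the revealed spins (`+1` on `K`, `−1` on the frontier) as
boundary condition keeps every insulating vertex adjacent to the new region at spin `−1` — a
vertex of `K` is never adjacent to the new region, since its neighbours in `U ∖ K` form the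
frontier. [cite: DuminilCopinSmirnov2012Clay, §6.1, proof of Thm. 6.1] -/
theorem plusInsulated_explore {T₀ : Set V} {U K : Finset V} {ξ : SpinConfig V} (hins : PlusInsulated G T₀ U ξ) :
    PlusInsulated G T₀ (U \ (K ∪ frontierIn G U K)) (overrideOn (K ∪ frontierIn G U K) (clusterPattern K) ξ) := by
  intro v hvT hvU' huv
  obtain ⟨u, huU', huv⟩ := huv
  obtain ⟨huU, huS⟩ := Finset.mem_sdiff.1 huU'
  by_cases hvS : v ∈ K ∪ frontierIn G U K
  · rw [overrideOn_of_mem _ _ hvS]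
    rcases Finset.mem_union.1 hvS with hvK | hvF
    · exact absurd (Finset.mem_union_right _ (mem_frontierIn.2
        ⟨huU, fun huK ↦ huS (Finset.mem_union_left _ huK), v, hvK, huv.symm⟩)) huS
    · have hvK : v ∉ K := (mem_frontierIn.1 hvF).2.1
      simp [clusterPattern, hvK]
  · rw [overrideOn_of_notMem _ _ hvS]
    have hvU : v ∉ U := fun hvU ↦ hvU' (Finset.mem_sdiff.2 ⟨hvU, hvS⟩)
    exact hins v hvT hvU ⟨u, huU, huv⟩

/-- **Many separated `+` crossing clusters cost a geometric factor** (Duminil-Copin–Smirnov 2012,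
proof of Thm. 6.1, eq. (6.1), "successive conditionings", here for the Ising model, `+` clusters,
and without planar topology; this is the estimate behind Condition G for the spin interface,
Kemppainen–Smirnov 2017, Rem. 2.10, iterated over the clusters). For `β ≥ 0`: if every sub-region
`U ⊆ U₀` with an insulated boundary condition `ξ` satisfies `μ^ξ_{U;β,0}(plusCrossing U) ≤ θ`,
then for all such `(U, ξ)`, all `j` and all decreasing measurable events `F`,
`μ^ξ_{U;β,0}(plusArms U j ∩ F) ≤ θ^j μ^ξ_{U;β,0}(F)`. See the module docstring for the proof.
[cite: DuminilCopinSmirnov2012Clay, Thm. 6.1 (proof, eq. (6.1))]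
[cite: KemppainenSmirnov2017, Rem. 2.10] -/
theorem isingMeasure_real_plusArms_le_pow_mul {β : ℝ} (hβ : 0 ≤ β) (T₀ : Set V) (In Out U₀ : Finset V)
    {θ : ℝ} (hθ : 0 ≤ θ)
    (hbase : ∀ U ⊆ U₀, ∀ ξ : SpinConfig V, PlusInsulated G T₀ U ξ →
      (isingMeasure G U β 0 (.fixed ξ)).real (plusCrossing G U In Out) ≤ θ)
    (j : ℕ) :
    ∀ U ⊆ U₀, ∀ ξ : SpinConfig V, PlusInsulated G T₀ U ξ →
      ∀ F : Set (SpinConfig V), IsLowerSet F → MeasurableSet F →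
      (isingMeasure G U β 0 (.fixed ξ)).real (plusArms G U In Out j ∩ F) ≤
        θ ^ j * (isingMeasure G U β 0 (.fixed ξ)).real F := by
  induction j with
  | zero =>
    intro U hU ξ hins F hF hFm
    rw [pow_zero, one_mul]
    exact measureReal_mono Set.inter_subset_right
  | succ j ih =>
    intro U hU ξ hins F hF hFm
    set μ := isingMeasure G U β 0 (.fixed ξ) with hμ
    -- the fibres of the explored cluster
    set B : Finset V → Set (SpinConfig V) := fun K₀ ↦
      {σ | (plusCrossers G U In Out σ).Nonempty ∧ explPlusCluster G U In Out σ = K₀} with hB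
    have hBdet : ∀ K₀, ∀ σ₁ σ₂ : SpinConfig V, (∀ x ∈ U, σ₁ x = σ₂ x) → (σ₁ ∈ B K₀ ↔ σ₂ ∈ B K₀) := by
      intro K₀ σ₁ σ₂ h
      simp only [hB, Set.mem_setOf_eq, plusCrossers_congr h, explPlusCluster_congr h]
    have hBm : ∀ K₀, MeasurableSet (B K₀) := fun K₀ ↦ measurableSet_of_determined U (hBdet K₀)
    have hBdisj : ∀ K₀ K₁, K₀ ≠ K₁ → Disjoint (B K₀) (B K₁) := by
      intro K₀ K₁ hne
      rw [Set.disjoint_left]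
      rintro σ ⟨-, h0⟩ ⟨-, h1⟩
      exact hne (h0.symm.trans h1)
    have hCm := measurableSet_plusCrossing (G := G) U In Out
    -- (1) the arms event is covered by the fibres indexed by the subsets of `U`
    have hcover : plusArms G U In Out (j + 1) ∩ F ⊆
        ⋃ K₀ ∈ U.powerset, B K₀ ∩ (plusArms G U In Out (j + 1) ∩ F) := by
      rintro σ ⟨hσA, hσF⟩
      have hne : (plusCrossers G U In Out σ).Nonempty := by
        obtain ⟨a, haIn, ha⟩ := plusArms_subset_plusCrossing U In Out (Nat.le_add_left 1 j) hσA
        exact ⟨a, mem_plusCrossers.2 ⟨haIn, ha⟩⟩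
      simp only [Set.mem_iUnion, Finset.mem_powerset, exists_prop]
      exact ⟨_, explPlusCluster_subset σ, ⟨hne, rfl⟩, hσA, hσF⟩
    -- (2) the fibrewise bound
    have hfib : ∀ K₀ : Finset V, μ.real (B K₀ ∩ (plusArms G U In Out (j + 1) ∩ F)) ≤
        θ ^ j * μ.real (B K₀ ∩ (plusCrossing G U In Out ∩ F)) := by
      intro K₀
      by_cases hex : (B K₀ ∩ (plusArms G U In Out (j + 1) ∩ F)).Nonempty
      swap
      · rw [Set.not_nonempty_iff_eq_empty.1 hex, measureReal_empty]
        exact mul_nonneg (pow_nonneg hθ j) measureReal_nonneg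
      obtain ⟨σ₀, ⟨h₀, hK₀⟩, hσ₀A, hσ₀F⟩ := hex
      -- exploration data of `σ₀`
      set a := (plusCrossers G U In Out σ₀).min' h₀ with ha
      obtain ⟨haIn, haU, ha1, ⟨b, hb, hbK⟩, hKreach, hmin⟩ := explPlusCluster_spec h₀
      rw [hK₀] at hbK hKreach hmin
      obtain ⟨hKU, hK1, hKfr, hKcl⟩ := cluster_spec haU ha1 hKreach
      have haK : a ∈ K₀ := (hKreach a).2 (Reachable.refl _)
      set S := K₀ ∪ frontierIn G U K₀ with hS
      set U' := U \ S with hU'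
      set ξ' := overrideOn S (clusterPattern K₀) ξ with hξ'
      set μ' := isingMeasure G U' β 0 (.fixed ξ') with hμ'
      set F' : Set (SpinConfig V) := F ∩ {σ | ∀ a' ∈ In, a' < a → ¬ IsPlusCrosser G U' Out σ a'} with hF'
      have hU'U : U' ⊆ U := Finset.sdiff_subset
      have hins' : PlusInsulated G T₀ U' ξ' := plusInsulated_explore G hins
      have hF'low : IsLowerSet F' := by
        rintro σ₁ σ₂ hle ⟨h1, h2⟩
        exact ⟨hF hle h1, fun a' ha' hlt hcr ↦ h2 a' ha' hlt (hcr.mono hle)⟩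
      have hF'm : MeasurableSet F' := by
        refine hFm.inter (measurableSet_of_determined U' fun σ₁ σ₂ h ↦ ?_)
        simp only [Set.mem_setOf_eq, isPlusCrosser_congr h]
      -- membership in the cylinder of the revealed pattern
      have hcyl_iff : ∀ σ : SpinConfig V, σ ∈ spinCyl S (clusterPattern K₀) ↔
          (∀ v ∈ K₀, σ v = 1) ∧ (∀ v ∈ frontierIn G U K₀, σ v = -1) := by
        intro σ
        simp only [mem_spinCyl, hS, Finset.mem_union]
        constructor
        · intro h
          refine ⟨fun v hv ↦ ?_, fun v hv ↦ ?_⟩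
          · have := h v (Or.inl hv); simpa [clusterPattern, hv] using this
          · have hvK : v ∉ K₀ := (mem_frontierIn.1 hv).2.1
            have := h v (Or.inr hv); simpa [clusterPattern, hvK] using this
        · rintro ⟨h1, h2⟩ v (hv | hv)
          · simp [clusterPattern, hv, h1 v hv]
          · have hvK : v ∉ K₀ := (mem_frontierIn.1 hv).2.1
            simp [clusterPattern, hvK, h2 v hv]
      -- (P1) the fibre inside the arms event lies in the cylinder cut by the smaller arms event
      have hP1 : B K₀ ∩ (plusArms G U In Out (j + 1) ∩ F) ⊆
          (plusArms G U' In Out j ∩ F') ∩ spinCyl S (clusterPattern K₀) := by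
        rintro σ ⟨⟨hne, hKσ⟩, hσA, hσF⟩
        have haσ : (plusCrossers G U In Out σ).min' hne = a :=
          min'_plusCrossers_eq h₀ hne (hKσ.trans hK₀.symm)
        obtain ⟨-, haUσ, ha1σ, -, hKreachσ, -⟩ := explPlusCluster_spec hne
        rw [hKσ, haσ] at hKreachσ
        rw [haσ] at ha1σ
        obtain ⟨-, hK1σ, hKfrσ, -⟩ := cluster_spec haU ha1σ hKreachσ
        refine ⟨⟨?_, hσF, ?_⟩, (hcyl_iff σ).2 ⟨hK1σ, hKfrσ⟩⟩
        · -- `j` arms in `U'`: drop the (at most one) arm inside `K₀`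
          obtain ⟨s, hscard, hscross, hssep⟩ := hσA
          have hsK : (s.filter fun v ↦ v ∈ K₀).card ≤ 1 := by
            rw [Finset.card_le_one]
            intro x hx y hy
            obtain ⟨hx, hxK⟩ := Finset.mem_filter.1 hx
            obtain ⟨hy, hyK⟩ := Finset.mem_filter.1 hy
            by_contra hxy
            exact hssep hx hy hxy (((hKreachσ x).1 hxK).symm.trans ((hKreachσ y).1 hyK))
          have hcard' : j ≤ (s.filter fun v ↦ v ∉ K₀).card := by
            have := Finset.card_filter_add_card_filter_not (s := s) (fun v ↦ v ∈ K₀)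
            omega
          obtain ⟨s', hs'sub, hs'card⟩ := Finset.exists_subset_card_eq hcard'
          refine ⟨s', hs'card, fun x hx ↦ ?_, fun x hx y hy hxy hr ↦ ?_⟩
          · obtain ⟨hxs, hxK⟩ := Finset.mem_filter.1 (hs'sub hx)
            obtain ⟨hxIn, hxU, hx1, b', hb', hxb'⟩ := hscross x hxs
            have hxF : x ∉ frontierIn G U K₀ := fun h' ↦ by
              have := hKfrσ x h'; rw [hx1] at this; exact absurd this (by decide)
            refine ⟨hxIn, Finset.mem_sdiff.2 ⟨hxU, ?_⟩, hx1, b', hb', (reachable_sdiff_iff hKfrσ hxK hxF b').1 hxb'⟩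
            intro h'
            rcases Finset.mem_union.1 h' with h' | h'
            · exact hxK h'
            · exact hxF h'
          · obtain ⟨hxs, -⟩ := Finset.mem_filter.1 (hs'sub hx)
            obtain ⟨hys, -⟩ := Finset.mem_filter.1 (hs'sub hy)
            exact hssep hxs hys hxy (hr.mono (plusGraph_mono_left hU'U _))
        · -- nothing below `a` crosses in `U'`
          intro a' ha'In hlt hcr
          have hcrU : a' ∈ plusCrossers G U In Out σ := mem_plusCrossers.2 ⟨ha'In, hcr.mono_left hU'U⟩
          have := Finset.min'_le _ _ hcrU
          rw [haσ] at this
          exact absurd hlt (not_lt.2 this)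
      -- (P2) the cylinder cut by `F'` lies in the fibre inside the crossing event
      have hP2 : F' ∩ spinCyl S (clusterPattern K₀) ⊆ B K₀ ∩ (plusCrossing G U In Out ∩ F) := by
        rintro σ ⟨⟨hσF, hbelow⟩, hσcyl⟩
        obtain ⟨hplus, hminus⟩ := (hcyl_iff σ).1 hσcyl
        have key := explPlusCluster_eq_of_pattern (σ₀ := σ₀) (σ := σ) h₀
          (fun v hv ↦ hplus v (by rwa [hK₀] at hv)) (fun v hv ↦ hminus v (by rwa [hK₀] at hv))
          (fun a' ha' hlt ↦ by rw [hK₀]; exact hbelow a' ha' hlt)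
        obtain ⟨hne, hKσ⟩ := key
        refine ⟨⟨hne, hKσ.trans hK₀⟩, ?_, hσF⟩
        obtain ⟨a', ha'⟩ := hne
        obtain ⟨ha'In, hcr⟩ := mem_plusCrossers.1 ha'
        exact ⟨a', ha'In, hcr⟩
      -- assemble
      calc μ.real (B K₀ ∩ (plusArms G U In Out (j + 1) ∩ F))
          ≤ μ.real ((plusArms G U' In Out j ∩ F') ∩ spinCyl S (clusterPattern K₀)) := measureReal_mono hP1
        _ = μ.real (spinCyl S (clusterPattern K₀)) * μ'.real (plusArms G U' In Out j ∩ F') :=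
            isingMeasure_fixed_real_inter_spinCyl G U S β 0 ξ _ ((measurableSet_plusArms U' In Out j).inter hF'm)
        _ ≤ μ.real (spinCyl S (clusterPattern K₀)) * (θ ^ j * μ'.real F') :=
            mul_le_mul_of_nonneg_left (ih U' (hU'U.trans hU) ξ' hins' F' hF'low hF'm) measureReal_nonneg
        _ = θ ^ j * (μ.real (spinCyl S (clusterPattern K₀)) * μ'.real F') := by ring
        _ = θ ^ j * μ.real (F' ∩ spinCyl S (clusterPattern K₀)) := by
            rw [isingMeasure_fixed_real_inter_spinCyl G U S β 0 ξ _ hF'm]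
        _ ≤ θ ^ j * μ.real (B K₀ ∩ (plusCrossing G U In Out ∩ F)) :=
            mul_le_mul_of_nonneg_left (measureReal_mono hP2) (pow_nonneg hθ j)
    -- (3) sum over the fibres
    have hdisj : (↑U.powerset : Set (Finset V)).PairwiseDisjoint fun K₀ ↦ B K₀ ∩ (plusCrossing G U In Out ∩ F) := by
      intro K₀ _ K₁ _ hne
      exact (hBdisj K₀ K₁ hne).mono Set.inter_subset_left Set.inter_subset_left
    have hFKG : μ.real (plusCrossing G U In Out ∩ F) ≤ θ * μ.real F := by
      rw [Set.inter_comm]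
      calc μ.real (F ∩ plusCrossing G U In Out) ≤ μ.real F * μ.real (plusCrossing G U In Out) :=
            isingMeasure_real_inter_le_mul_of_isLowerSet_of_isUpperSet G hβ U 0 (.fixed ξ) hF
              (isUpperSet_plusCrossing U In Out) hFm hCm
        _ ≤ μ.real F * θ := mul_le_mul_of_nonneg_left (hbase U hU ξ hins) measureReal_nonneg
        _ = θ * μ.real F := mul_comm _ _
    calc μ.real (plusArms G U In Out (j + 1) ∩ F)
        ≤ μ.real (⋃ K₀ ∈ U.powerset, B K₀ ∩ (plusArms G U In Out (j + 1) ∩ F)) :=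
          measureReal_mono hcover (measure_ne_top _ _)
      _ ≤ ∑ K₀ ∈ U.powerset, μ.real (B K₀ ∩ (plusArms G U In Out (j + 1) ∩ F)) :=
          measureReal_biUnion_finset_le _ _
      _ ≤ ∑ K₀ ∈ U.powerset, θ ^ j * μ.real (B K₀ ∩ (plusCrossing G U In Out ∩ F)) :=
          Finset.sum_le_sum fun K₀ _ ↦ hfib K₀
      _ = θ ^ j * μ.real (⋃ K₀ ∈ U.powerset, B K₀ ∩ (plusCrossing G U In Out ∩ F)) := by
          rw [← Finset.mul_sum, measureReal_biUnion_finset hdisj fun K₀ _ ↦ (hBm K₀).inter (hCm.inter hFm)]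
      _ ≤ θ ^ j * μ.real (plusCrossing G U In Out ∩ F) :=
          mul_le_mul_of_nonneg_left (measureReal_mono (Set.iUnion₂_subset fun K₀ _ ↦ Set.inter_subset_right))
            (pow_nonneg hθ j)
      _ ≤ θ ^ j * (θ * μ.real F) := mul_le_mul_of_nonneg_left hFKG (pow_nonneg hθ j)
      _ = θ ^ (j + 1) * μ.real F := by ring

end Main

/-! ### Arms avoiding the clusters of a seed set; the bound against events determined off the region -/

section Seed

variable {V : Type*} (G : SimpleGraph V) [DecidableEq V]

open scoped Classical in
/-- The **clusters of the seed set**: the vertices of `U` locally `+`-joined in `(U, σ)` to some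
`+` vertex of `Z ∩ U` (the union of the local `+` clusters of the `+` seeds). Explored first when
`Z` is a set of exceptional vertices of the region (next to the `+` boundary arc).
[cite: DuminilCopinSmirnov2012Clay, §6.1, proof of Thm. 6.1] -/
def seedPlusCluster (U Z : Finset V) (σ : SpinConfig V) : Finset V :=
  U.filter fun v ↦ ∃ z ∈ Z, z ∈ U ∧ σ z = 1 ∧ (plusGraph G U σ).Reachable z v

variable {G}

/-- Membership in the clusters of the seed set. [folklore] -/
theorem mem_seedPlusCluster_iff {U Z : Finset V} {σ : SpinConfig V} (v : V) :
    v ∈ seedPlusCluster G U Z σ ↔ ∃ z ∈ Z, z ∈ U ∧ σ z = 1 ∧ (plusGraph G U σ).Reachable z v := by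
  classical
  rw [seedPlusCluster, Finset.mem_filter, and_iff_right_iff_imp]
  rintro ⟨z, -, hzU, hz1, hzv⟩
  exact (mem_and_eq_one_of_reachable hzU hz1 hzv).1

/-- The clusters of the seed set only depend on the spins of the region. [folklore] -/
theorem seedPlusCluster_congr {U Z : Finset V} {σ₁ σ₂ : SpinConfig V} (h : ∀ x ∈ U, σ₁ x = σ₂ x) :
    seedPlusCluster G U Z σ₁ = seedPlusCluster G U Z σ₂ := by
  ext v
  simp only [mem_seedPlusCluster_iff, plusGraph_eq_of_agree h]
  constructor
  · rintro ⟨z, hz, hzU, hz1, hr⟩; exact ⟨z, hz, hzU, (h z hzU) ▸ hz1, hr⟩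
  · rintro ⟨z, hz, hzU, hz1, hr⟩; exact ⟨z, hz, hzU, (h z hzU).symm ▸ hz1, hr⟩

/-- **Structure of the clusters of the seed set**: they lie in `U`, carry spin `+1`, their
frontier carries spin `−1`, the seeds of `U` outside them carry spin `−1`, and they are the
vertices locally `+`-reachable from the `+` seeds of `U`. [folklore] -/
theorem seedPlusCluster_spec (U Z : Finset V) (σ : SpinConfig V) :
    seedPlusCluster G U Z σ ⊆ U ∧ (∀ v ∈ seedPlusCluster G U Z σ, σ v = 1) ∧
    (∀ v ∈ frontierIn G U (seedPlusCluster G U Z σ), σ v = -1) ∧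
    (∀ z ∈ Z, z ∈ U → z ∉ seedPlusCluster G U Z σ → σ z = -1) ∧
    (∀ v, v ∈ seedPlusCluster G U Z σ ↔
      ∃ z ∈ {z : V | z ∈ Z ∧ z ∈ U ∧ σ z = 1}, (plusGraph G U σ).Reachable z v) := by
  have hK : ∀ v, v ∈ seedPlusCluster G U Z σ ↔
      ∃ z ∈ {z : V | z ∈ Z ∧ z ∈ U ∧ σ z = 1}, (plusGraph G U σ).Reachable z v := by
    intro v
    rw [mem_seedPlusCluster_iff]
    simp only [Set.mem_setOf_eq]
    constructor
    · rintro ⟨z, hz, hzU, hz1, hr⟩; exact ⟨z, ⟨hz, hzU, hz1⟩, hr⟩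
    · rintro ⟨z, ⟨hz, hzU, hz1⟩, hr⟩; exact ⟨z, hz, hzU, hz1, hr⟩
  obtain ⟨h1, h2, h3, -⟩ := plusSeedCluster_spec (G := G) (fun z hz ↦ ⟨hz.2.1, hz.2.2⟩) hK
  refine ⟨h1, h2, h3, fun z hz hzU hzK ↦ ?_, hK⟩
  rcases Int.units_eq_one_or (σ z) with hz1 | hz1
  · exact absurd ((mem_seedPlusCluster_iff z).2 ⟨z, hz, hzU, hz1, Reachable.refl _⟩) hzK
  · exact hz1

/-- **The fibre of the seed datum, from inside**: a configuration equal to `+1` on the seed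
clusters `K` of `σ₀`, to `−1` on their frontier and to `−1` on the seeds of `U` outside `K` has
the same seed clusters. [folklore] -/
theorem seedPlusCluster_eq_of_pattern {U Z : Finset V} {σ₀ σ : SpinConfig V}
    (hplus : ∀ v ∈ seedPlusCluster G U Z σ₀, σ v = 1)
    (hminus : ∀ v ∈ frontierIn G U (seedPlusCluster G U Z σ₀), σ v = -1)
    (hZ : ∀ z ∈ Z, z ∈ U → z ∉ seedPlusCluster G U Z σ₀ → σ z = -1) :
    seedPlusCluster G U Z σ = seedPlusCluster G U Z σ₀ := by
  set K := seedPlusCluster G U Z σ₀ with hKdef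
  obtain ⟨hKU, hK1, hKfr, hZ₀, hK⟩ := seedPlusCluster_spec (G := G) U Z σ₀
  -- the `+` seeds of `σ` and `σ₀` coincide
  have hseeds : ∀ z ∈ Z, z ∈ U → (σ z = 1 ↔ σ₀ z = 1) := by
    intro z hz hzU
    constructor
    · intro hz1
      by_contra h0
      have hzK : z ∉ K := fun hzK ↦ h0 (hK1 z hzK)
      have := hZ z hz hzU hzK
      rw [hz1] at this
      exact absurd this (by decide)
    · intro hz1
      exact hplus z ((hK z).2 ⟨z, ⟨hz, hzU, hz1⟩, Reachable.refl _⟩)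
  ext v
  rw [mem_seedPlusCluster_iff]
  rw [← plusSeedReachable_iff_of_pattern (G := G) (fun z hz ↦ ⟨hz.2.1, hz.2.2⟩) hK hplus hminus v]
  simp only [Set.mem_setOf_eq]
  constructor
  · rintro ⟨z, hz, hzU, hz1, hr⟩; exact ⟨z, ⟨hz, hzU, (hseeds z hz hzU).1 hz1⟩, hr⟩
  · rintro ⟨z, ⟨hz, hzU, hz1⟩, hr⟩; exact ⟨z, hz, hzU, (hseeds z hz hzU).2 hz1, hr⟩

variable (G) [G.LocallyFinite] [Countable V] [LinearOrder V]

/-- **Many separated `+` crossing clusters avoiding the seeds cost a geometric factor**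
(DCS 2012, eq. (6.1), in the form needed when the `+` arc of a Dobrushin domain enters the band).
Under the one-crossing hypothesis of `isingMeasure_real_plusArms_le_pow_mul` for the sub-regions
of `U₀` and a seed set `Z ⊆ U₀`: if every insulating vertex outside `U₀` adjacent to `U₀` either
carries boundary spin `−1` or has all its `U₀`-neighbours in `Z`, then
`μ^ξ_{U₀;β,0}(plusArmsAvoiding U₀ Z j) ≤ θ^j`. Proof: reveal the seeds and the local `+` clusters
of the `+` seeds (their frontier is `−`, so the rest of the region is insulated), then apply the
theorem fibrewise. [cite: DuminilCopinSmirnov2012Clay, Thm. 6.1 (proof, eq. (6.1))] -/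
theorem isingMeasure_real_plusArmsAvoiding_le_pow {β : ℝ} (hβ : 0 ≤ β) (T₀ : Set V) (In Out U₀ Z : Finset V)
    (hZU : Z ⊆ U₀) {θ : ℝ} (hθ : 0 ≤ θ)
    (hbase : ∀ U ⊆ U₀, ∀ ξ : SpinConfig V, PlusInsulated G T₀ U ξ →
      (isingMeasure G U β 0 (.fixed ξ)).real (plusCrossing G U In Out) ≤ θ)
    (j : ℕ) (ξ : SpinConfig V)
    (hT : ∀ v ∈ T₀, v ∉ U₀ → (∃ u ∈ U₀, G.Adj u v) → ξ v = -1 ∨ ∀ u ∈ U₀, G.Adj u v → u ∈ Z) :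
    (isingMeasure G U₀ β 0 (.fixed ξ)).real (plusArmsAvoiding G U₀ In Out Z j) ≤ θ ^ j := by
  have main := isingMeasure_real_plusArms_le_pow_mul G hβ T₀ In Out U₀ hθ hbase j
  set μ := isingMeasure G U₀ β 0 (.fixed ξ) with hμ
  -- the fibres of the seed datum
  set D : Finset V → Set (SpinConfig V) := fun K ↦ {σ | seedPlusCluster G U₀ Z σ = K} with hD
  have hDm : ∀ K, MeasurableSet (D K) := fun K ↦
    measurableSet_of_determined U₀ fun σ₁ σ₂ h ↦ by simp only [hD, Set.mem_setOf_eq, seedPlusCluster_congr h]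
  have hdisj : (↑U₀.powerset : Set (Finset V)).PairwiseDisjoint D := by
    intro K₀ _ K₁ _ hne
    rw [Function.onFun, Set.disjoint_left]
    intro σ h0 h1
    exact hne (h0.symm.trans h1)
  have hcover : plusArmsAvoiding G U₀ In Out Z j ⊆ ⋃ K ∈ U₀.powerset, D K ∩ plusArmsAvoiding G U₀ In Out Z j := by
    intro σ hσ
    simp only [Set.mem_iUnion, Finset.mem_powerset, exists_prop]
    exact ⟨_, (seedPlusCluster_spec (G := G) U₀ Z σ).1, rfl, hσ⟩
  -- fibrewise bound
  have hfib : ∀ K : Finset V, μ.real (D K ∩ plusArmsAvoiding G U₀ In Out Z j) ≤ θ ^ j * μ.real (D K) := by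
    intro K
    by_cases hex : (D K ∩ plusArmsAvoiding G U₀ In Out Z j).Nonempty
    swap
    · rw [Set.not_nonempty_iff_eq_empty.1 hex, measureReal_empty]
      exact mul_nonneg (pow_nonneg hθ j) measureReal_nonneg
    obtain ⟨σ₀, hK₀, -⟩ := hex
    have hK₀' : seedPlusCluster G U₀ Z σ₀ = K := hK₀
    set S := K ∪ frontierIn G U₀ K ∪ Z with hS
    set U₁ := U₀ \ S with hU₁
    set ξ₁ := overrideOn S (clusterPattern K) ξ with hξ₁
    set μ₁ := isingMeasure G U₁ β 0 (.fixed ξ₁) with hμ₁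
    have hU₁U : U₁ ⊆ U₀ := Finset.sdiff_subset
    -- (i) the fibre inside the avoiding-arms event lies in the cylinder cut by the arms event of `U₁`
    have hP1 : D K ∩ plusArmsAvoiding G U₀ In Out Z j ⊆ plusArms G U₁ In Out j ∩ spinCyl S (clusterPattern K) := by
      rintro σ ⟨hKσ, s, hscard, hscross, hsZ, hssep⟩
      have hKσ' : seedPlusCluster G U₀ Z σ = K := hKσ
      obtain ⟨hKU, hK1, hKfr, hZm, hKreach⟩ := seedPlusCluster_spec (G := G) U₀ Z σ
      rw [hKσ'] at hKU hK1 hKfr hZm hKreach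
      refine ⟨⟨s, hscard, fun x hx ↦ ?_, fun x hx y hy hxy hr ↦ ?_⟩, fun v hv ↦ ?_⟩
      · obtain ⟨hxIn, hxU, hx1, b', hb', hxb'⟩ := hscross x hx
        have hxK : x ∉ K := fun hxK ↦ by
          obtain ⟨z, hz, hzx⟩ := (hKreach x).1 hxK
          exact hsZ x hx z hz.1 hzx.symm
        have hxF : x ∉ frontierIn G U₀ K := fun h' ↦ by
          have := hKfr x h'; rw [hx1] at this; exact absurd this (by decide)
        have hxZ : x ∉ Z := fun hxZ ↦ hsZ x hx x hxZ (Reachable.refl _)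
        have hgraph : plusGraph G U₁ σ = plusGraph G (U₀ \ (K ∪ frontierIn G U₀ K)) σ := by
          have hU₁eq : U₀ \ (K ∪ frontierIn G U₀ K ∪ Z) = (U₀ \ (K ∪ frontierIn G U₀ K)) \ Z := by
            ext v; simp only [Finset.mem_sdiff, Finset.mem_union]; tauto
          rw [hU₁, hS, hU₁eq]
          exact plusGraph_sdiff_eq_of_minus fun v hvZ hvU ↦
            hZm v hvZ (Finset.mem_sdiff.1 hvU).1 fun hvK ↦ (Finset.mem_sdiff.1 hvU).2 (Finset.mem_union_left _ hvK)
        refine ⟨hxIn, Finset.mem_sdiff.2 ⟨hxU, ?_⟩, hx1, b', hb', ?_⟩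
        · intro h'
          rcases Finset.mem_union.1 h' with h' | h'
          · rcases Finset.mem_union.1 h' with h' | h'
            · exact hxK h'
            · exact hxF h'
          · exact hxZ h'
        · rw [hgraph]
          exact (reachable_sdiff_iff hKfr hxK hxF b').1 hxb'
      · exact hssep hx hy hxy (hr.mono (plusGraph_mono_left hU₁U _))
      · by_cases hvK : v ∈ K
        · simp [clusterPattern, hvK, hK1 v hvK]
        · simp only [clusterPattern, hvK, if_false]
          rcases Finset.mem_union.1 hv with hv | hv
          · rcases Finset.mem_union.1 hv with hv | hv
            · exact absurd hv hvK
            · exact hKfr v hv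
          · exact hZm v hv (hZU hv) hvK
    -- (ii) the cylinder lies in the fibre
    have hP2 : spinCyl S (clusterPattern K) ⊆ D K := by
      intro σ hσ
      have hat : ∀ v ∈ S, σ v = clusterPattern K v := hσ
      have hplus : ∀ v ∈ K, σ v = 1 := fun v hv ↦ by
        have := hat v (Finset.mem_union_left _ (Finset.mem_union_left _ hv)); simpa [clusterPattern, hv] using this
      have hminus : ∀ v ∈ frontierIn G U₀ K, σ v = -1 := fun v hv ↦ by
        have hvK : v ∉ K := (mem_frontierIn.1 hv).2.1
        have := hat v (Finset.mem_union_left _ (Finset.mem_union_right _ hv)); simpa [clusterPattern, hvK] using this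
      have hZ' : ∀ z ∈ Z, z ∈ U₀ → z ∉ K → σ z = -1 := fun z hz _ hzK ↦ by
        have := hat z (Finset.mem_union_right _ hz); simpa [clusterPattern, hzK] using this
      show seedPlusCluster G U₀ Z σ = K
      rw [← hK₀']
      exact seedPlusCluster_eq_of_pattern (hK₀'.symm ▸ hplus) (hK₀'.symm ▸ hminus) (hK₀'.symm ▸ hZ')
    -- (iii) the smaller region is insulated
    have hins₁ : PlusInsulated G T₀ U₁ ξ₁ := by
      intro v hvT hvU₁ huv
      obtain ⟨u, huU₁, huv⟩ := huv
      obtain ⟨huU, huS⟩ := Finset.mem_sdiff.1 huU₁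
      by_cases hvS : v ∈ S
      · rw [hξ₁, overrideOn_of_mem _ _ hvS]
        by_cases hvK : v ∈ K
        · exact absurd (Finset.mem_union_left _ (Finset.mem_union_right _ (mem_frontierIn.2
            ⟨huU, fun huK ↦ huS (Finset.mem_union_left _ (Finset.mem_union_left _ huK)), v, hvK, huv.symm⟩))) huS
        · simp [clusterPattern, hvK]
      · rw [hξ₁, overrideOn_of_notMem _ _ hvS]
        have hvU : v ∉ U₀ := fun hvU ↦ hvU₁ (Finset.mem_sdiff.2 ⟨hvU, hvS⟩)
        rcases hT v hvT hvU ⟨u, huU, huv⟩ with h | h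
        · exact h
        · exact absurd (Finset.mem_union_right _ (h u huU huv)) huS
    -- assemble
    calc μ.real (D K ∩ plusArmsAvoiding G U₀ In Out Z j)
        ≤ μ.real (plusArms G U₁ In Out j ∩ spinCyl S (clusterPattern K)) := measureReal_mono hP1
      _ = μ.real (spinCyl S (clusterPattern K)) * μ₁.real (plusArms G U₁ In Out j) :=
          isingMeasure_fixed_real_inter_spinCyl G U₀ S β 0 ξ _ (measurableSet_plusArms U₁ In Out j)
      _ ≤ μ.real (spinCyl S (clusterPattern K)) * θ ^ j := by
          refine mul_le_mul_of_nonneg_left ?_ measureReal_nonneg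
          have h1 := main U₁ hU₁U ξ₁ hins₁ Set.univ isLowerSet_univ MeasurableSet.univ
          rwa [Set.inter_univ, probReal_univ, mul_one] at h1
      _ = θ ^ j * μ.real (spinCyl S (clusterPattern K)) := mul_comm _ _
      _ ≤ θ ^ j * μ.real (D K) := mul_le_mul_of_nonneg_left (measureReal_mono hP2) (pow_nonneg hθ j)
  calc μ.real (plusArmsAvoiding G U₀ In Out Z j)
      ≤ μ.real (⋃ K ∈ U₀.powerset, D K ∩ plusArmsAvoiding G U₀ In Out Z j) :=
        measureReal_mono hcover (measure_ne_top _ _)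
    _ ≤ ∑ K ∈ U₀.powerset, μ.real (D K ∩ plusArmsAvoiding G U₀ In Out Z j) := measureReal_biUnion_finset_le _ _
    _ ≤ ∑ K ∈ U₀.powerset, θ ^ j * μ.real (D K) := Finset.sum_le_sum fun K _ ↦ hfib K
    _ = θ ^ j * μ.real (⋃ K ∈ U₀.powerset, D K) := by
        rw [← Finset.mul_sum, measureReal_biUnion_finset hdisj fun K _ ↦ hDm K]
    _ ≤ θ ^ j * 1 := mul_le_mul_of_nonneg_left measureReal_le_one (pow_nonneg hθ j)
    _ = θ ^ j := mul_one _

/-- **`j` separated `+` crossing clusters avoiding the seeds cost `θ^j` against every event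
determined outside the region** (DCS 2012, proof of Thm. 6.1: the bound (6.1) holds "uniformly in
the configuration outside the annulus", which the product over scales consumes). Under the
hypotheses of `isingMeasure_real_plusArmsAvoiding_le_pow`, for a volume `Λ ⊇ U₀` with boundary
condition `η` such that every insulating vertex outside `U₀` adjacent to `U₀` either lies outside
`Λ` with `η = −1` or has all its `U₀`-neighbours in `Z`:
`μ^η_{Λ;β,0}(plusArmsAvoiding U₀ Z j ∩ E) ≤ θ^j μ^η_{Λ;β,0}(E)` for every measurable event `E`
determined by the spins off `U₀`. [cite: DuminilCopinSmirnov2012Clay, Thm. 6.1 (proof, eq. (6.1)–(6.2))] -/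
theorem isingMeasure_real_plusArmsAvoiding_inter_le {β : ℝ} (hβ : 0 ≤ β) (T₀ : Set V) (In Out U₀ Z : Finset V)
    (hZU : Z ⊆ U₀) {θ : ℝ} (hθ : 0 ≤ θ)
    (hbase : ∀ U ⊆ U₀, ∀ ξ : SpinConfig V, PlusInsulated G T₀ U ξ →
      (isingMeasure G U β 0 (.fixed ξ)).real (plusCrossing G U In Out) ≤ θ)
    (j : ℕ) {Λ : Finset V} (hU₀Λ : U₀ ⊆ Λ) (η : SpinConfig V)
    (hT : ∀ v ∈ T₀, v ∉ U₀ → (∃ u ∈ U₀, G.Adj u v) → (v ∉ Λ ∧ η v = -1) ∨ ∀ u ∈ U₀, G.Adj u v → u ∈ Z)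
    {E : Set (SpinConfig V)} (hE : MeasurableSet E)
    (hEdet : ∀ σ₁ σ₂ : SpinConfig V, (∀ x ∉ U₀, σ₁ x = σ₂ x) → (σ₁ ∈ E ↔ σ₂ ∈ E)) :
    (isingMeasure G Λ β 0 (.fixed η)).real (plusArmsAvoiding G U₀ In Out Z j ∩ E) ≤
      θ ^ j * (isingMeasure G Λ β 0 (.fixed η)).real E := by
  have hA := measurableSet_plusArmsAvoiding (G := G) U₀ In Out Z j
  have key : isingMeasure G Λ β 0 (.fixed η) (plusArmsAvoiding G U₀ In Out Z j ∩ E) ≤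
      ENNReal.ofReal (θ ^ j) * isingMeasure G Λ β 0 (.fixed η) E := by
    refine isingMeasure_fixed_inter_le_mul_of_support G hU₀Λ β 0 η hA hE hEdet fun ζ hζ ↦ ?_
    have hT' : ∀ v ∈ T₀, v ∉ U₀ → (∃ u ∈ U₀, G.Adj u v) → ζ v = -1 ∨ ∀ u ∈ U₀, G.Adj u v → u ∈ Z := by
      intro v hvT hvU huv
      rcases hT v hvT hvU huv with ⟨hvΛ, hv⟩ | h
      · exact Or.inl ((hζ v hvΛ).trans hv)
      · exact Or.inr h
    have h1 := isingMeasure_real_plusArmsAvoiding_le_pow G hβ T₀ In Out U₀ Z hZU hθ hbase j ζ hT'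
    rw [← ENNReal.ofReal_toReal (measure_ne_top _ _)]
    exact ENNReal.ofReal_le_ofReal h1
  have h2 := ENNReal.toReal_mono (ENNReal.mul_ne_top ENNReal.ofReal_ne_top (measure_ne_top _ _)) key
  rwa [ENNReal.toReal_mul, ENNReal.toReal_ofReal (pow_nonneg hθ j)] at h2

end Seed

end Literature.Probability.LatticeModels

end
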